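import Literature.RingTheory.CohomologyAnnihilator.QuotientSyzygies
import Mathlib.RingTheory.Ideal.AssociatedPrime.Finiteness
import Mathlib.CategoryTheory.Abelian.Projective.Dimension
import HarnessLib

/-!
# Strong generators: change of syzygy degree, the unit ideal case, prime filtrations

Topic: `Literature/RingTheory/CohomologyAnnihilator`. Bookkeeping for the Dao–Takahashi induction
proving [IyengarTakahashi2014, Theorems 5.1, 5.2] (`StrongGeneratorInduction.lean`), in the
vocabulary of `StrongGenerator.lean` (`IsSyzygy`, `InTower`, `IsRetractOfPower`). Write
"`Ωᵈ(mod A) ⊆ |G|ₙ`" for: `G` is finitely generated and every finitely generated `A`-module has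
SOME `d`-th syzygy in `|G|ₙ` (the form of the hypothesis `hgen` of
`singEqVCa_essFiniteType_of_strongGenerator`). This file proves:

* `exists_generator_isSyzygy_add` / `exists_generator_isSyzygy_of_le` — raising the degree:
  `Ωᵈ(mod A) ⊆ |G|ₙ ⟹ Ω^{d'}(mod A) ⊆ |G'|ₙ'` for `d ≤ d'` (higher syzygies of the tower,
  `exists_generator_isSyzygy_inTower`);
* `hasProjectiveDimensionLT_of_isSyzygy` and
  `exists_generator_of_cohomologyAnnihilatorOfDegree_eq_top` — if `ca^{d+1}(A) = A` then every
  `d`-th syzygy of a finitely generated module is projective, so `Ωᵈ(mod A) ⊆ |A|₁`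
  (Example 2.5; this covers fields, the base of the induction, and the degenerate case of an
  invertible cohomology annihilator);
* `exists_primeFiltration` — a noetherian ring has ideals `0 = I₀ ≤ I₁ ≤ ⋯ ≤ Iₘ = A` and primes
  `𝔭ᵢ` with `𝔭ᵢ Iᵢ₊₁ ⊆ Iᵢ` (from Mathlib's prime filtration `Iᵢ₊₁/Iᵢ ≅ A/𝔭ᵢ`);
* `exists_generator_of_forall_prime` — **the non-domain step of the proof of Theorem 5.1**: if
  `Ωᵈ(mod A/𝔭) ⊆ |G_𝔭|_{n_𝔭}` for every prime `𝔭`, then `Ωᵈ(mod A) ⊆ |G|ₙ` for some `G`, `n`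
  ("there are exact sequences `0 → IᵢM → Iᵢ₊₁M → Iᵢ₊₁M/IᵢM → 0` … it then follows from
  [DaoTakahashi, Corollary 5.5] that there exists a `G` …"): the quotients `Iᵢ₊₁M/IᵢM` are
  `A/𝔭ᵢ`-modules, their syzygies over `A` come from `exists_generator_isSyzygy_restrictScalars`,
  and the horseshoe lemma glues them along the filtration.

## References

* S. B. Iyengar, R. Takahashi, *Annihilation of cohomology and strong generation of module
  categories*, IMRN 2016; arXiv:1404.1476 — Example 2.5, proof of Theorem 5.1.
  [`IyengarTakahashi2014`]
* H. Dao, R. Takahashi, *The radius of a subcategory of modules*, Algebra Number Theory 8 (2014),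
  Corollary 5.5. [`DaoTakahashi2014`]
-/

noncomputable section

open CategoryTheory CategoryTheory.Limits

universe u

namespace Literature.RingTheory.CohomologyAnnihilator

variable {A : Type u} [CommRing A]

/-! ## Finite products as generators -/

/-- Each factor `T i` of a finite product `Π j, T j` lies in `add (Π j, T j)`. [folklore] -/
private theorem isRetractOfPower_pi_eval {m : ℕ} (T : Fin m → ModuleCat.{u} A) (i : Fin m) :
    IsRetractOfPower (ModuleCat.of A (Π j, T j)) (T i) :=
  (isRetractOfPower_self _).of_retract
    (ModuleCat.ofHom (LinearMap.single A (fun j => (T j : Type u)) i))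
    (ModuleCat.ofHom (LinearMap.proj i))
    (by
      apply ModuleCat.hom_ext
      exact LinearMap.ext fun x => by simp)

/-! ## Raising the syzygy degree -/

/-- If `Ωᵈ(mod A) ⊆ |G|ₙ` then `Ω^{j+d}(mod A) ⊆ |G'|ₙ₊₁` for the generator `G' = G_j` of
`exists_generator_isSyzygy_inTower` (take any `j`-th syzygy of the given `d`-th syzygy).
[cite: IyengarTakahashi2014, Thm. 5.1 (proof)] -/
theorem exists_generator_isSyzygy_add [IsNoetherianRing A] {G : ModuleCat.{u} A}
    [Module.Finite A G] {d n : ℕ}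
    (hgen : ∀ M : ModuleCat.{u} A, Module.Finite A M →
      ∃ K : ModuleCat.{u} A, IsSyzygy d M K ∧ InTower G n K) (j : ℕ) :
    ∃ G' : ModuleCat.{u} A, Module.Finite A G' ∧ ∃ n' : ℕ, ∀ M : ModuleCat.{u} A,
      Module.Finite A M → ∃ K : ModuleCat.{u} A, IsSyzygy (j + d) M K ∧ InTower G' n' K := by
  obtain ⟨G', hG', h⟩ := exists_generator_isSyzygy_inTower G j
  refine ⟨G', hG', n + 1, fun M hM => ?_⟩
  obtain ⟨K₀, hK₀, hK₀T⟩ := hgen M hM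
  haveI : Module.Finite A K₀ := hK₀T.finite
  obtain ⟨K, -, hK⟩ := exists_isSyzygy K₀ j
  exact ⟨K, hK₀.trans hK, h (Nat.succ_pos n) hK₀T.succ hK⟩

/-- If `Ωᵈ(mod A) ⊆ |G|ₙ` and `d ≤ d'` then `Ω^{d'}(mod A) ⊆ |G'|ₙ'` for some finitely generated
`G'` and some `n'`. [cite: IyengarTakahashi2014, Thm. 5.1 (proof)] -/
theorem exists_generator_isSyzygy_of_le [IsNoetherianRing A] {d d' : ℕ} (hdd' : d ≤ d')
    (hgen : ∃ G : ModuleCat.{u} A, Module.Finite A G ∧ ∃ n : ℕ, ∀ M : ModuleCat.{u} A,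
      Module.Finite A M → ∃ K : ModuleCat.{u} A, IsSyzygy d M K ∧ InTower G n K) :
    ∃ G : ModuleCat.{u} A, Module.Finite A G ∧ ∃ n : ℕ, ∀ M : ModuleCat.{u} A,
      Module.Finite A M → ∃ K : ModuleCat.{u} A, IsSyzygy d' M K ∧ InTower G n K := by
  obtain ⟨j, rfl⟩ := Nat.exists_eq_add_of_le' hdd'
  obtain ⟨G, hG, n, h⟩ := hgen
  haveI := hG
  exact exists_generator_isSyzygy_add h j

/-! ## The case `ca^{d+1}(A) = A` (Example 2.5) -/

/-- Projective dimension shifts along syzygies: if `pd M < n + 1 + s` and `K = Ωˢ M` then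
`pd K < n + 1`. [folklore] -/
private theorem hasProjectiveDimensionLT_of_isSyzygy :
    ∀ (s : ℕ) {M K : ModuleCat.{u} A}, IsSyzygy s M K → ∀ n : ℕ,
      HasProjectiveDimensionLT M (n + 1 + s) → HasProjectiveDimensionLT K (n + 1)
  | 0, _, _, ⟨e⟩, n, h => by
    haveI : HasProjectiveDimensionLT _ (n + 1) := h
    exact hasProjectiveDimensionLT_of_iso e.symm (n + 1)
  | s + 1, _, _, ⟨K', P, hK', _, hP, f, g, w, hS⟩, n, h => by
    have h' : HasProjectiveDimensionLT K' (n + 1 + 1) :=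
      hasProjectiveDimensionLT_of_isSyzygy s hK' (n + 1)
        (by rwa [show n + 1 + 1 + s = n + 1 + (s + 1) by omega])
    haveI : Projective P := hP
    have hP' : HasProjectiveDimensionLT (ShortComplex.mk f g w).X₂ (n + 1) :=
      hasProjectiveDimensionLT_of_ge P 1 (n + 1) (by omega)
    exact hS.hasProjectiveDimensionLT_X₁ (n + 1) hP' h'

/-- **The unit ideal case**: over a noetherian ring with `ca^{d+1}(A) = A` every finitely
generated module has projective dimension `≤ d` (Example 2.5), so each of its `d`-th syzygies is
a finitely generated projective, i.e. lies in `add A = |A|₁`; thus `Ωᵈ(mod A) ⊆ |A|₁`. (For a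
field and `d = 0` this is the base case "`dim R = 0`" of the proof of Theorem 5.1 in the form
needed for Theorem 5.2.) [cite: IyengarTakahashi2014, Example 2.5] -/
theorem exists_generator_of_cohomologyAnnihilatorOfDegree_eq_top [IsNoetherianRing A] {d : ℕ}
    (h : cohomologyAnnihilatorOfDegree A (d + 1) = ⊤) :
    ∃ G : ModuleCat.{u} A, Module.Finite A G ∧ ∃ n : ℕ, ∀ M : ModuleCat.{u} A,
      Module.Finite A M → ∃ K : ModuleCat.{u} A, IsSyzygy d M K ∧ InTower G n K := by
  refine ⟨ModuleCat.of A A, inferInstance, 1, fun M hM => ?_⟩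
  haveI := hM
  obtain ⟨K, hKfin, hK⟩ := exists_isSyzygy M d
  have hMpd : HasProjectiveDimensionLT M (0 + 1 + d) := by
    rw [Nat.zero_add, Nat.add_comm]
    exact hasProjectiveDimensionLT_of_cohomologyAnnihilatorOfDegree_eq_top h M
  have hKpd : HasProjectiveDimensionLT K (0 + 1) :=
    hasProjectiveDimensionLT_of_isSyzygy d hK 0 hMpd
  have hKproj : Projective K :=
    projective_iff_hasProjectiveDimensionLT_one.mpr (by simpa using hKpd)
  exact ⟨K, hK, InTower.of_isRetractOfPower
    (IsRetractOfPower.of_projective (isRetractOfPower_self _) hKfin hKproj)⟩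

/-! ## Prime filtrations of a noetherian ring -/

/-- If `N₂/N₁ ≅ A/𝔭` (`Submodule.IsQuotientEquivQuotientPrime`) then `N₁ ≤ N₂` and
`𝔭 N₂ ⊆ N₁` for some prime `𝔭`. [folklore] -/
private theorem exists_prime_smul_le_of_isQuotientEquivQuotientPrime {M : Type u} [AddCommGroup M]
    [Module A M] {N₁ N₂ : Submodule A M} (h : N₁.IsQuotientEquivQuotientPrime N₂) :
    N₁ ≤ N₂ ∧ ∃ 𝔭 : PrimeSpectrum A, 𝔭.1 • N₂ ≤ N₁ := by
  obtain ⟨hle, 𝔭, ⟨e⟩⟩ := h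
  refine ⟨hle, 𝔭, Submodule.smul_le.mpr fun r hr y hy => ?_⟩
  have h0 : e ((N₁.submoduleOf N₂).mkQ (r • ⟨y, hy⟩)) = 0 := by
    rw [map_smul, map_smul]
    obtain ⟨z, hz⟩ := Ideal.Quotient.mk_surjective (e ((N₁.submoduleOf N₂).mkQ ⟨y, hy⟩))
    rw [← hz, ← Ideal.Quotient.mk_eq_mk, ← Submodule.Quotient.mk_smul,
      Submodule.Quotient.mk_eq_zero, smul_eq_mul]
    exact Ideal.mul_mem_right _ _ hr
  rw [LinearEquiv.map_eq_zero_iff, Submodule.mkQ_apply, Submodule.Quotient.mk_eq_zero] at h0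
  exact h0

/-- **Prime filtration of a noetherian ring**, in the weak form used in the proof of Theorem 5.1:
there are ideals `0 = I₀ ≤ I₁ ≤ ⋯ ≤ Iₘ = A` and prime ideals `𝔭₀, …, 𝔭ₘ₋₁` with
`𝔭ᵢ · Iᵢ₊₁ ⊆ Iᵢ` ("one can choose ideals `(0) = I₀ ⊂ I₁ ⊂ ⋯ ⊂ Iₘ = R` such that
`Iᵢ₊₁/Iᵢ ≅ R/𝔭ᵢ`"; Mathlib: `IsNoetherianRing.exists_relSeries_isQuotientEquivQuotientPrime`).
[cite: IyengarTakahashi2014, Thm. 5.1 (proof)] -/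
theorem exists_primeFiltration [IsNoetherianRing A] :
    ∃ (m : ℕ) (I : Fin (m + 1) → Ideal A) (𝔭 : Fin m → PrimeSpectrum A),
      I 0 = ⊥ ∧ I (Fin.last m) = ⊤ ∧
        ∀ i : Fin m, I i.castSucc ≤ I i.succ ∧ (𝔭 i).1 * I i.succ ≤ I i.castSucc := by
  obtain ⟨s, hs0, hs1⟩ := IsNoetherianRing.exists_relSeries_isQuotientEquivQuotientPrime A A
  have hstep : ∀ i : Fin s.length,
      (s i.castSucc).IsQuotientEquivQuotientPrime (s i.succ) := fun i => s.step i
  choose 𝔭 h𝔭 using fun i => (exists_prime_smul_le_of_isQuotientEquivQuotientPrime (hstep i)).2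
  exact ⟨s.length, s, 𝔭, hs0, hs1, fun i =>
    ⟨(exists_prime_smul_le_of_isQuotientEquivQuotientPrime (hstep i)).1, h𝔭 i⟩⟩

/-! ## Gluing generators along a prime filtration -/

/-- A submodule equal to `⊥` is a zero object of `ModuleCat A`. [folklore] -/
private theorem isZero_of_submodule_eq_bot {M : Type u} [AddCommGroup M] [Module A M] {N : Submodule A M}
    (hN : N = ⊥) : IsZero (ModuleCat.of A N) := by
  haveI : Subsingleton N := ⟨fun a b => Subtype.ext (by
    rw [(Submodule.eq_bot_iff N).mp hN a.1 a.2, (Submodule.eq_bot_iff N).mp hN b.1 b.2])⟩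
  exact ModuleCat.isZero_of_subsingleton _

/-- The short exact sequence `0 → N₁ → N₂ → N₂/N₁ → 0` of a pair of submodules `N₁ ≤ N₂`.
[folklore] -/
private theorem exists_shortExact_inclusion {M : Type u} [AddCommGroup M] [Module A M]
    {N₁ N₂ : Submodule A M} (h : N₁ ≤ N₂) :
    ∃ w : ModuleCat.ofHom (Submodule.inclusion h) ≫
        ModuleCat.ofHom (N₁.submoduleOf N₂).mkQ = 0,
      (ShortComplex.mk (ModuleCat.ofHom (X := ModuleCat.of A N₁) (Y := ModuleCat.of A N₂)
        (Submodule.inclusion h))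
        (ModuleCat.ofHom (X := ModuleCat.of A N₂)
          (Y := ModuleCat.of A (N₂ ⧸ N₁.submoduleOf N₂)) (N₁.submoduleOf N₂).mkQ) w).ShortExact :=
  exists_shortExact_of_linearMap (Y := ModuleCat.of A N₁) (M := ModuleCat.of A N₂)
    (X := ModuleCat.of A (N₂ ⧸ N₁.submoduleOf N₂)) (Submodule.inclusion h)
    (N₁.submoduleOf N₂).mkQ (Submodule.inclusion_injective h) (Submodule.mkQ_surjective _) (by
      rw [LinearMap.exact_iff, Submodule.ker_mkQ, Submodule.range_inclusion]
      rfl)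

/-- For ideals `𝔭 J ⊆ I`, the quotient `JM/IM` (of submodules of any module `M`) is `𝔭`-torsion.
[folklore] -/
private theorem isTorsionBySet_quotient_smul_top {M : Type u} [AddCommGroup M] [Module A M]
    {I J 𝔭 : Ideal A} (h : 𝔭 * J ≤ I) :
    Module.IsTorsionBySet A
      (↥(J • (⊤ : Submodule A M)) ⧸ (I • (⊤ : Submodule A M)).submoduleOf (J • ⊤)) 𝔭 := by
  rintro x ⟨a, ha⟩
  induction x using Submodule.Quotient.induction_on with
  | _ y =>
    rw [← Submodule.Quotient.mk_smul, Submodule.Quotient.mk_eq_zero]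
    change a • y.1 ∈ I • (⊤ : Submodule A M)
    have hy : a • y.1 ∈ (𝔭 * J) • (⊤ : Submodule A M) := by
      rw [Submodule.mul_smul]
      exact Submodule.smul_mem_smul ha y.2
    exact Submodule.smul_mono_left h hy

/-- **The non-domain step of the proof of [IyengarTakahashi2014, Theorem 5.1]** (as needed for
Theorem 5.2): over a noetherian ring `A`, if for every prime `𝔭` there are a finitely generated
`A/𝔭`-module `G_𝔭` and `n_𝔭` with `Ωᵈ(mod A/𝔭) ⊆ |G_𝔭|_{n_𝔭}`, then `Ωᵈ(mod A) ⊆ |G|ₙ` for some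
finitely generated `A`-module `G` and some `n`. Proof as printed: choose ideals
`0 = I₀ ≤ ⋯ ≤ Iₘ = A` with `𝔭ᵢ Iᵢ₊₁ ⊆ Iᵢ` (`exists_primeFiltration`); for `M ∈ mod A` the
quotients `Iᵢ₊₁M/IᵢM` of the filtration `IᵢM` are finitely generated `A/𝔭ᵢ`-modules, so by
[DaoTakahashi2014, Cor. 5.5] (`exists_generator_isSyzygy_restrictScalars`) they have `d`-th
syzygies over `A` in `|G_{𝔭ᵢ}|_A ⊕ Cᵢ|_{n_{𝔭ᵢ} + d}`; the horseshoe lemma along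
`0 → IᵢM → Iᵢ₊₁M → Iᵢ₊₁M/IᵢM → 0` then puts a `d`-th syzygy of `M = IₘM` into `|G|_{m N}` for
`G = ⊕ᵢ (G_{𝔭ᵢ}|_A ⊕ Cᵢ)` and `N = Σᵢ (n_{𝔭ᵢ} + d)`.
[cite: IyengarTakahashi2014, Thm. 5.1 (proof); DaoTakahashi2014, Cor. 5.5] -/
theorem exists_generator_of_forall_prime [IsNoetherianRing A] (d : ℕ)
    (hprime : ∀ (𝔭 : Ideal A) [𝔭.IsPrime], ∃ G : ModuleCat.{u} (A ⧸ 𝔭),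
      Module.Finite (A ⧸ 𝔭) G ∧ ∃ n : ℕ, ∀ M : ModuleCat.{u} (A ⧸ 𝔭), Module.Finite (A ⧸ 𝔭) M →
        ∃ K : ModuleCat.{u} (A ⧸ 𝔭), IsSyzygy d M K ∧ InTower G n K) :
    ∃ G : ModuleCat.{u} A, Module.Finite A G ∧ ∃ n : ℕ, ∀ M : ModuleCat.{u} A,
      Module.Finite A M → ∃ K : ModuleCat.{u} A, IsSyzygy d M K ∧ InTower G n K := by
  -- the filtration of `A` and the generators over the `A/𝔭ᵢ`
  obtain ⟨m, I, 𝔭, hI0, hI1, hstep⟩ := exists_primeFiltration (A := A)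
  have hprime' : ∀ q : PrimeSpectrum A, ∃ G : ModuleCat.{u} (A ⧸ q.1),
      Module.Finite (A ⧸ q.1) G ∧ ∃ n : ℕ, ∀ M : ModuleCat.{u} (A ⧸ q.1),
        Module.Finite (A ⧸ q.1) M → ∃ K : ModuleCat.{u} (A ⧸ q.1), IsSyzygy d M K ∧ InTower G n K :=
    fun q => hprime q.1
  choose Gq hGq nq hnq using hprime'
  choose C hC hCgen using fun q : PrimeSpectrum A =>
    exists_generator_isSyzygy_restrictScalars (R := A) q.1 d
  -- the global generator `G = Π ι, (G_{𝔭ᵢ}|_A ⊕ Cᵢ)` and the level `m * B`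
  let T : Fin m → ModuleCat.{u} A := fun i =>
    ModuleCat.of A ((restrictScalarsFunctor A (A ⧸ (𝔭 i).1)).obj (Gq (𝔭 i)) × C (𝔭 i))
  let G : ModuleCat.{u} A := ModuleCat.of A (Π j, T j)
  let B : ℕ := ∑ j : Fin m, (nq (𝔭 j) + d)
  have hB : ∀ i : Fin m, nq (𝔭 i) + d ≤ B := fun i =>
    Finset.single_le_sum (f := fun j => nq (𝔭 j) + d) (fun j _ => Nat.zero_le _)
      (Finset.mem_univ i)
  haveI hTfin : ∀ j, Module.Finite A (T j) := fun j => by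
    haveI := hGq (𝔭 j)
    haveI := hC (𝔭 j)
    haveI : Module.Finite A ((restrictScalarsFunctor A (A ⧸ (𝔭 j).1)).obj (Gq (𝔭 j))) :=
      finite_restrictScalars_of_surjective Ideal.Quotient.mk_surjective _
    exact Module.Finite.prod
  have hGfin : Module.Finite A G := Module.Finite.pi
  refine ⟨G, hGfin, m * B, fun M hM => ?_⟩
  haveI := hM
  -- the filtration `Fᵢ = Iᵢ M` of `M`
  let F : Fin (m + 1) → Submodule A M := fun i => I i • ⊤
  -- induction along the filtration
  have key : ∀ k : ℕ, ∀ hk : k ≤ m, ∃ E : ModuleCat.{u} A,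
      IsSyzygy d (ModuleCat.of A (F ⟨k, Nat.lt_succ_of_le hk⟩)) E ∧ InTower G (k * B) E := by
    intro k
    induction k with
    | zero =>
      intro hk
      have hF0 : F ⟨0, Nat.lt_succ_of_le hk⟩ = ⊥ := by
        change I 0 • ⊤ = ⊥
        rw [hI0, Submodule.bot_smul]
      exact ⟨ModuleCat.of A PUnit.{u + 1},
        isSyzygy_punit_of_isZero (isZero_of_submodule_eq_bot hF0) d,
        InTower.of_isZero G _ (ModuleCat.isZero_of_subsingleton _)⟩
    | succ k ih =>
      intro hk
      obtain ⟨E, hE, hET⟩ := ih (Nat.le_of_succ_le hk)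
      let i : Fin m := ⟨k, hk⟩
      obtain ⟨hle, hpI⟩ := hstep i
      have hF : F i.castSucc ≤ F i.succ := Submodule.smul_mono_left hle
      -- the quotient `Q = I_{k+1}M / I_kM`, an `A/𝔭ᵢ`-module
      let Q : Type u := ↥(F i.succ) ⧸ (F i.castSucc).submoduleOf (F i.succ)
      have hQtors : Module.IsTorsionBySet A Q (𝔭 i).1 := isTorsionBySet_quotient_smul_top hpI
      letI := hQtors.module
      haveI : Module.Finite A (F i.succ) := Module.IsNoetherian.finite A _
      haveI : Module.Finite (A ⧸ (𝔭 i).1) Q := finite_of_isTorsionBySet (𝔭 i).1 Q hQtors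
      obtain ⟨ε⟩ := nonempty_iso_restrictScalars_of_isTorsionBySet (𝔭 i).1 Q hQtors
      -- a `d`-th syzygy of `Q` over `A/𝔭ᵢ` in the tower, transported to `A`
      obtain ⟨KQ, hKQ, hKQT⟩ := hnq (𝔭 i) (ModuleCat.of (A ⧸ (𝔭 i).1) Q) inferInstance
      obtain ⟨K, hK, hKT⟩ := hCgen (𝔭 i) hKQ inferInstance hKQT
      have hK' : IsSyzygy d (ModuleCat.of A Q) K := hK.of_iso_base ε
      have hKT' : InTower G B K :=
        InTower.mono (hB i) (hKT.mono_gen (isRetractOfPower_pi_eval T i))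
      -- horseshoe along `0 → I_kM → I_{k+1}M → Q → 0`
      obtain ⟨w, hS⟩ := exists_shortExact_inclusion (A := A) hF
      obtain ⟨E', hE', f', g', w', hS'⟩ := exists_isSyzygy_of_shortExact hS hE hK'
      refine ⟨E', hE', ?_⟩
      rw [Nat.succ_mul]
      exact InTower.of_shortExact hET hKT' hS'
  -- `M = IₘM`
  obtain ⟨E, hE, hET⟩ := key m le_rfl
  have hFm : F ⟨m, Nat.lt_succ_of_le le_rfl⟩ = ⊤ := by
    change I (Fin.last m) • ⊤ = ⊤
    rw [hI1, Submodule.top_smul]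
  let e : ModuleCat.of A (F ⟨m, Nat.lt_succ_of_le le_rfl⟩) ≅ M :=
    (LinearEquiv.ofEq _ _ hFm ≪≫ₗ Submodule.topEquiv).toModuleIso
  exact ⟨E, hE.of_iso_base e, hET⟩

end Literature.RingTheory.CohomologyAnnihilator

end
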